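import Literature.MathematicalPhysics.StatisticalMechanics.NJLExponentialClustering
import Literature.MathematicalPhysics.StatisticalMechanics.CapacityPartitionFunctionConnectedness
import Mathlib.Topology.Algebra.MvPolynomial
import HarnessLib

/-!
# Theorem 3.11 of Salmhofer–Seiler for the truncated `n`-point functions, with the tree length
# (Salmhofer–Seiler, CMP 139 (1991), Thm. 3.11 (3.32); Erratum CMP 146 (1992) (1)–(3))

Salmhofer–Seiler, p. 407: **Theorem 3.11.** "In the NJL system exponential clustering holds for all
`m ∈ 𝒲`. More specifically, if `w₁ = 1`,
  `|⟨σ_{x₁} ⋯ σ_{x_n}⟩^T| ≤ C(n) e^{-κ(m) ϑ(x₁,…,x_n)}`                                     (3.32)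
where `κ(m) > 0` for all `m ∈ 𝒲`, `⟨·⟩^T` is the truncated expectation value and `ϑ(x₁,…,x_n)` is
the length of a minimal tree on `{x₁,…,x_n}`."  Erratum: "For all `m ∈ 𝒲` there is a `κ(m) > 0`
such that for all `n ∈ ℕ` and `x₁,…,x_n ∈ ℤ^ν`, `|⟨σ^L⟩^T| ≤ C_n B_n(m) e^{-κ(m) ϑ(x₁,…,x_n)}` (1),
where `C_n` depends only on `n` and `m₀` …"; Remark 3.12: "`κ(m)` … is independent of the number of
spins `n` occurring in the `n`-point-function (3.32)".

The tree has the case `n = 2` (`NJLExponentialClustering`) and the Erratum's pair form (7)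
(`NJLPairClustering`).  This file proves the statement for every `n`, for arbitrary local monomial
observables `σ^{L_1}, …, σ^{L_n}` (`L_i` multi-indices on `ℤ^ν`, read on the torus), uniformly in the
volume, with the decay governed by the TREE LENGTH `ϑ` = the least number of lattice bonds of a bond
set linking the supports (`MonomerDimer.steiner`, computed on the torus on which the observables are
planted).  Road (replacing the cluster expansion of the printed proof, pp. 408–409):

* `MonomerDimer.Z_rescale` — the capacity partition functions are homogeneous:
  scaling the site data by `r^j` and the bond data by `r^{2j}` multiplies `Z(c)` by `r^{|c|}`; hence
  `njlCapZ_eq_eval_njlZgen`: `Z_Λ(c)(m) = m^{|c|} · Z̃(c)|_{t_b = m^{-2}}`, where `Z̃` is the partition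
  function with formal bond variables of `CapacityPartitionFunctionConnectedness`;
* `njlTruncated` — the truncated function `⟨σ^{L_{i₁}}; …; σ^{L_{i_n}}⟩_Λ(m)` (`Ursell.ursell` of the
  correlation functions of the partial products); `njlTruncated_eq` — for large `|m|` it equals
  `m^{-|L|} · (Z̃(N)|_{m^{-2}})^{-n} · Ũ|_{t = m^{-2}}`, `Ũ` the cleared Ursell polynomial;
* `njlTruncated_isBigO` — **the order of vanishing at `m = ∞` is at least `|L| + 2ϑ`**, because every
  monomial of `Ũ` has degree `≥ ϑ` (the support theorem
  `MonomerDimer.steiner_le_degree_of_mem_support_ursellGen`);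
* `norm_njlTruncated_joukowskiMass_le` — the uniform majorant `2^{n²} A(r)^{|L|}` outside the
  ellipse `E_r` (the Erratum's `C_n B_n(m)`), from `Ursell.norm_ursell_le` and the Heilmann–Lieb
  majorant `norm_njlCorrelation_joukowskiMass_le`;
* **`njl_truncated_clustering_joukowskiMass`** — Thm. 3.11 for every `n`, every volume:
  `|⟨σ^{L_1}; …; σ^{L_n}⟩_Λ(m(w))| ≤ 2^{n²} A(r)^{|L|} (|w|/r)^{|L| + 2ϑ}` for `0 < |w| < r < 1`,
  `m(w) = (√(2ν)/2)(w⁻¹ - w)` — by the tree's Penrose–Lebowitz/Schwarz step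
  `norm_le_mul_pow_of_isBigO_cobounded`; the rate per unit tree length, `2 log(r/|w|)`, is the same
  as for `n = 2` and does not depend on `n` (Remark 3.12);
* `njl_truncated_clustering_of_mem`, **`njl_truncated_exponentialClustering`** — for every `m` off
  `i[-√(2ν), √(2ν)]`: ONE `κ(m) > 0` such that for all `n`, all families and all volumes
  `|⟨…⟩^T_Λ(m)| ≤ 2^{n²} A^{|L|} e^{-κ(m) ϑ}`.

Faithfulness / scope.  The observables are planted on the torus `(ℤ/Lℤ)^ν` inside an embedded box
(`|x|_∞ ≤ R`, `2R < L`), as everywhere in this series, and `ϑ` is the Steiner bond number of the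
planted supports in the torus graph — "the length of a minimal tree on `{x₁,…,x_n}`" read on the
finite volume where the expectation is taken (for fixed points and `L → ∞` it is eventually the
`ℤ^ν` Steiner number; that comparison and the thermodynamic limit are left to a companion file).
The prefactor depends on `m` through the ellipse parameter `r` as the Erratum requires; the truncation
is the standard one (`TruncatedCorrelationFunction`).  `β = 0` NJL statements on tori only; nothing
about `β > 0`, the continuum, `SU(N)`, a mass gap or the summit's `QCD` conjunct.

## References

* M. Salmhofer, E. Seiler, *Proof of chiral symmetry breaking in strongly coupled lattice gauge
  theory*, Commun. Math. Phys. 139 (1991) 395–432: Thm. 3.11 (3.32) p. 407, proof pp. 408–409,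
  Remark 3.12. [SalmhoferSeiler1991]
* M. Salmhofer, E. Seiler, Erratum, Commun. Math. Phys. 146 (1992) 637–638: (1)–(3).
  [SalmhoferSeiler1992Erratum]
* O. Penrose, J. L. Lebowitz, Commun. Math. Phys. 39 (1974) 165–184, Lemma 5. [PenroseLebowitz1974]
-/

noncomputable section

open MvPolynomial Finset Filter Asymptotics Bornology Topology

namespace Literature.MathematicalPhysics.StatisticalMechanics

/-! ### Homogeneity of the capacity partition functions -/

namespace MonomerDimer

variable {V β R : Type*} [CommRing R] [Fintype V] [Fintype β]

omit [Fintype V] [Fintype β] in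
/-- The scaling endomorphism `σ_v ↦ r σ_v` multiplies the `σ^c`-coefficient by `r^{|c|}`. [folklore] -/
private theorem coeff_aeval_smul_X (r : R) (p : MvPolynomial V R) (c : V →₀ ℕ) :
    coeff c (aeval (fun v => C r * X v) p) = r ^ c.degree * coeff c p := by
  classical
  induction p using MvPolynomial.induction_on' with
  | monomial d a =>
    rw [aeval_monomial, algebraMap_eq, coeff_monomial]
    have hprod : (d.prod fun v e => (C r * X v : MvPolynomial V R) ^ e) =
        C (r ^ d.degree) * d.prod fun v e => (X v : MvPolynomial V R) ^ e := by
      rw [Finsupp.prod, Finsupp.prod, Finsupp.degree_apply, ← prod_pow_eq_pow_sum, map_prod,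
        ← prod_mul_distrib]
      refine prod_congr rfl fun v _ => ?_
      rw [mul_pow, C_pow]
    rw [hprod, ← mul_assoc, ← C_mul, ← monomial_eq, coeff_monomial]
    split_ifs with h
    · subst h; ring
    · rw [mul_zero]
  | add p q hp hq => rw [map_add, coeff_add, coeff_add, hp, hq, mul_add]

/-- **Homogeneity.**  Scaling the site Taylor data by `r^j` and the bond Taylor data by `r^{2j}`
(i.e. `σ_x ↦ r σ_x` in the Boltzmann polynomial) multiplies `Z(c)` by `r^{|c|}`: each unit of
capacity carries one power of the spin variable. [cite: SalmhoferSeiler1991, Def. 3.1 and Remark 3.2] -/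
theorem Z_rescale (D : ℕ) (s t : β → V) (f : V → ℕ → R) (g : β → ℕ → R) (r : R) (c : V →₀ ℕ) :
    Z D s t (fun x j => r ^ j * f x j) (fun b j => r ^ (2 * j) * g b j) c =
      r ^ c.degree * Z D s t f g c := by
  set φ : MvPolynomial V R →ₐ[R] MvPolynomial V R := aeval fun v => C r * X v with hφ
  have hs : ∀ x, φ (siteFactor D f x) = siteFactor D (fun x j => r ^ j * f x j) x := by
    intro x
    unfold siteFactor
    rw [map_sum]
    refine sum_congr rfl fun j _ => ?_
    simp only [map_mul, map_pow, hφ, aeval_C, aeval_X, algebraMap_eq]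
    ring
  have hb : ∀ b, φ (bondFactor D s t g b) = bondFactor D s t (fun b j => r ^ (2 * j) * g b j) b := by
    intro b
    unfold bondFactor
    rw [map_sum]
    refine sum_congr rfl fun j _ => ?_
    simp only [map_mul, map_pow, hφ, aeval_C, aeval_X, algebraMap_eq]
    ring
  have hB : φ (boltzmann D s t f g) =
      boltzmann D s t (fun x j => r ^ j * f x j) (fun b j => r ^ (2 * j) * g b j) := by
    unfold boltzmann
    rw [map_mul, map_prod, map_prod]
    simp_rw [hs, hb]
  unfold Z
  rw [← hB, hφ, coeff_aeval_smul_X]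

end MonomerDimer

namespace ComplexSpin

open MonomerDimer
open Literature.Probability.LatticeModels (TorusSite Site)
open Literature.Probability.LatticeModels

variable {ν L : ℕ}

/-! ### The NJL system with formal bond variables -/

section Generic

variable [NeZero L]

/-- The NJL site data at mass `1`: `(2N)^j/j!`. [cite: SalmhoferSeiler1991, Def. 3.3(1)] -/
def njlSiteDataOne (N : ℕ) : TorusSite ν L → ℕ → ℂ :=
  fun _ j => (2 * N : ℂ) ^ j / (Nat.factorial j : ℂ)

/-- The NJL bond Taylor data `N^j/j!` in `ℂ`. [cite: SalmhoferSeiler1991, Def. 3.3(1)] -/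
def njlBondCoeffC (N : ℕ) : TorusSite ν L × Fin ν → ℕ → ℂ :=
  fun _ j => ((njlBondCoeff N j : ℝ) : ℂ)

/-- The NJL capacity partition function with a formal variable `t_b` per bond (mass scaled to `1`):
`Z̃_Λ(c) ∈ ℂ[t_b]`. [cite: SalmhoferSeiler1991, Def. 3.3(1) and Remark 3.2] -/
def njlZgen (N : ℕ) (c : TorusSite ν L →₀ ℕ) : MvPolynomial (TorusSite ν L × Fin ν) ℂ :=
  Zgen N linkSrc linkTgt (njlSiteDataOne N) (njlBondCoeffC N) c

/-- **`Z_Λ(c)(m) = m^{|c|} · Z̃_Λ(c)|_{t ≡ m^{-2}}`** (`m ≠ 0`): the mass dependence of the NJL capacity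
partition functions is carried by one power of `m` per unit of capacity and one factor `m^{-2}` per
unit of bond occupation. [cite: SalmhoferSeiler1991, Remark 3.2 and Remark 3.10] -/
theorem njlCapZ_eq_eval_njlZgen (N : ℕ) (c : TorusSite ν L →₀ ℕ) {m : ℂ} (hm : m ≠ 0) :
    njlCapZ N c m = m ^ c.degree * eval (fun _ => m⁻¹ ^ 2) (njlZgen N c) := by
  rw [njlZgen, eval_Zgen, ← Z_rescale]
  unfold njlCapZ
  congr 1
  · funext x j
    simp only [njlSiteData, njlSiteDataOne]
    rw [mul_pow, mul_div_assoc, mul_comm]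
    ring
  · funext b j
    simp only [njlBondData, njlBondCoeffC, scaledBond]
    have h1 : m ^ (2 * j) * (m⁻¹ ^ 2) ^ j = 1 := by
      rw [pow_mul, ← mul_pow, ← mul_pow, mul_inv_cancel₀ hm, one_pow, one_pow]
    rw [← mul_assoc, mul_comm (m ^ (2 * j)), mul_assoc, h1, mul_one]

/-- With all bond variables at `0`, `Z̃_Λ(c) = ∏_x (2N)^{c_x}/c_x!` (`c ≤ N`); in particular it is
nonzero. [cite: SalmhoferSeiler1991, (3.7)] -/
theorem eval_zero_njlZgen (N : ℕ) {c : TorusSite ν L →₀ ℕ} (hc : ∀ x, c x ≤ N) :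
    eval (0 : TorusSite ν L × Fin ν → ℂ) (njlZgen N c) =
      ∏ x, (2 * N : ℂ) ^ (c x) / (Nat.factorial (c x) : ℂ) := by
  classical
  rw [njlZgen, eval_Zgen, Z_trivialBonds N linkSrc linkTgt _ _ (fun b => ?_) hc]
  · rfl
  · apply bondFactor_eq_one
    · simp [scaledBond, njlBondCoeffC, njlBondCoeff]
    · intro j hj
      simp [scaledBond, zero_pow (Nat.one_le_iff_ne_zero.1 hj)]

/-- `Z̃_Λ(c)|_{t=0} ≠ 0` (`N ≥ 1`, `c ≤ N`). [cite: SalmhoferSeiler1991, (3.7)] -/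
theorem eval_zero_njlZgen_ne_zero {N : ℕ} (hN : 1 ≤ N) {c : TorusSite ν L →₀ ℕ} (hc : ∀ x, c x ≤ N) :
    eval (0 : TorusSite ν L × Fin ν → ℂ) (njlZgen N c) ≠ 0 := by
  rw [eval_zero_njlZgen N hc]
  refine prod_ne_zero_iff.2 fun x _ => div_ne_zero (pow_ne_zero _ ?_) ?_
  · have h2N : (2 * N : ℕ) ≠ 0 := by omega
    exact_mod_cast h2N
  · exact_mod_cast (Nat.factorial_pos _).ne'

end Generic


/-! ### The truncated functions of the NJL system -/

section Truncated

variable {ι : Type*} [LinearOrder ι]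

/-- **The truncated `n`-point function** `⟨σ^{L_{i₁}}; …; σ^{L_{i_n}}⟩_Λ(m)` of the NJL system on the
torus `(ℤ/Lℤ)^ν` at complex mass `m`: the Ursell function (`TruncatedCorrelationFunction`) of the
finite-volume correlation functions `A ↦ ⟨∏_{i∈A} σ^{L_i}⟩_Λ(m) = ⟨σ^{∑_{i∈A} L_i}⟩_Λ(m)` of the family
of local monomial observables `σ^{L_i}`, `L_i` multi-indices on `ℤ^ν` read on the torus, `i ∈ S`.
For `n = 2` this is `⟨σ^{L₁}σ^{L₂}⟩_Λ - ⟨σ^{L₁}⟩_Λ⟨σ^{L₂}⟩_Λ` (`Ursell.ursell_pair`). [cite: SalmhoferSeiler1991, Thm. 3.11 (3.32)–(3.33)] -/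
def njlTruncated (N L : ℕ) [NeZero L] (d : ι → Site ν →₀ ℕ) (S : Finset ι) (m : ℂ) : ℂ :=
  Ursell.ursell (fun A => njlCorrelation N L (∑ i ∈ A, d i) m) S

/-- The family read on the torus: `L_i` planted at the origin. [cite: SalmhoferSeiler1991, (3.30)] -/
def plantFamily (L : ℕ) (d : ι → Site ν →₀ ℕ) : ι → TorusSite ν L →₀ ℕ :=
  fun i => plant (0 : TorusSite ν L) (d i)

/-- **The tree length** `ϑ(L_{i₁}, …, L_{i_n})` of the family on the torus `(ℤ/Lℤ)^ν`: the least
number of lattice bonds of a bond set linking the supports of the planted observables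
(`MonomerDimer.steiner`) — "the length of a minimal tree on `{x₁, …, x_n}`". [cite: SalmhoferSeiler1991, Thm. 3.11 (3.32)] -/
def njlTreeLength (L : ℕ) (d : ι → Site ν →₀ ℕ) (S : Finset ι) : ℕ :=
  steiner (linkSrc (ν := ν) (L := L)) linkTgt (plantFamily L d) S

variable [NeZero L]

/-- The truncated functions are holomorphic in the mass on the zero-free region (finite sums of
products of correlation functions). [cite: SalmhoferSeiler1991, Thm. 3.8 and Thm. 3.11] -/
theorem differentiableOn_njlTruncated (N L : ℕ) [NeZero L] (d : ι → Site ν →₀ ℕ) (S : Finset ι) :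
    DifferentiableOn ℂ (njlTruncated (ν := ν) N L d S) (njlMassRegion ν) := by
  unfold njlTruncated
  induction S using Finset.strongInduction with
  | H S ih =>
    have h : (fun m => Ursell.ursell (fun A => njlCorrelation N L (∑ i ∈ A, d i) m) S) =
        fun m => njlCorrelation N L (∑ i ∈ S, d i) m -
          ∑ A ∈ Ursell.anchored S, Ursell.ursell (fun B => njlCorrelation N L (∑ i ∈ B, d i) m) A *
            njlCorrelation N L (∑ i ∈ S \ A, d i) m := by
      funext m
      rw [Ursell.ursell_eq]
    rw [h]
    refine (differentiableOn_njlCorrelation N L _).sub (DifferentiableOn.fun_sum fun A hA => ?_)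
    exact (ih A (Ursell.ssubset_of_mem_anchored hA)).fun_mul (differentiableOn_njlCorrelation N L _)

variable {N R : ℕ} {d : ι → Site ν →₀ ℕ} {S : Finset ι}

omit [LinearOrder ι] [NeZero L] in
/-- The total multi-index of a sub-family lies under the capacities. [cite: SalmhoferSeiler1991, Def. 3.7] -/
private theorem sum_apply_le_of_subset (hdN : ∀ x, (∑ i ∈ S, d i) x ≤ N) {A : Finset ι}
    (hA : A ⊆ S) (x : Site ν) : (∑ i ∈ A, d i) x ≤ N := by
  refine le_trans ?_ (hdN x)
  rw [Finsupp.finsetSum_apply, Finsupp.finsetSum_apply]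
  exact Finset.sum_le_sum_of_subset hA

omit [LinearOrder ι] [NeZero L] in
/-- The support of the total multi-index of a sub-family lies in the box. [cite: SalmhoferSeiler1991, Def. 3.7] -/
private theorem box_of_subset (hbox : ∀ i ∈ S, ∀ x ∈ (d i).support, ∀ j, |x j| ≤ (R : ℤ))
    {A : Finset ι} (hA : A ⊆ S) : ∀ x ∈ (∑ i ∈ A, d i).support, ∀ j, |x j| ≤ (R : ℤ) := by
  classical
  intro x hx j
  obtain ⟨i, hi, hix⟩ := Finset.mem_biUnion.1 (Finsupp.support_finsetSum hx)
  exact hbox i (hA hi) x hix j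

omit [LinearOrder ι] [NeZero L] in
/-- The planted total multi-index is the sum of the planted family. [cite: SalmhoferSeiler1991, (3.30)] -/
private theorem plant_sum (L : ℕ) (A : Finset ι) :
    plant (0 : TorusSite ν L) (∑ i ∈ A, d i) = ∑ i ∈ A, plantFamily L d i := by
  unfold plant plantFamily plant
  rw [Finsupp.mapDomain_finsetSum]

omit [LinearOrder ι] in
/-- The planted total multi-index fits under the top capacity `(N, …, N)`. [cite: SalmhoferSeiler1991, Remark 3.2] -/
private theorem plant_sum_le_top (hL : 2 * R < L)
    (hbox : ∀ i ∈ S, ∀ x ∈ (d i).support, ∀ j, |x j| ≤ (R : ℤ))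
    (hdN : ∀ x, (∑ i ∈ S, d i) x ≤ N) {A : Finset ι} (hA : A ⊆ S) :
    ∑ i ∈ A, plantFamily L d i ≤ topExponent (ν := ν) (L := L) N := by
  classical
  rw [← plant_sum]
  intro y
  rw [topExponent_apply']
  by_cases hy : y ∈ (plant (0 : TorusSite ν L) (∑ i ∈ A, d i)).support
  · unfold plant at hy ⊢
    obtain ⟨x, hx, rfl⟩ : ∃ x ∈ (∑ i ∈ A, d i).support, (0 : TorusSite ν L) + Torus.proj L x = y := by
      simpa using Finsupp.mapDomain_support hy
    rw [Finsupp.mapDomain_apply' {x : Site ν | ∀ j, |x j| ≤ (R : ℤ)} (∑ i ∈ A, d i)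
      (fun z hz => box_of_subset hbox hA z (Finset.mem_coe.1 hz))
      (fun v hv w hw h => torusProj_injOn_box hL hv hw (add_left_cancel h))
      (box_of_subset hbox hA x hx)]
    exact sum_apply_le_of_subset hdN hA x
  · rw [Finsupp.notMem_support_iff.1 hy]
    exact Nat.zero_le _

omit [LinearOrder ι] in
/-- The correlation function of a sub-family as a ratio of capacity partition functions.
[cite: SalmhoferSeiler1991, Remark 3.2 and (3.30)] -/
private theorem correlation_eq_div (hL : 2 * R < L)
    (hbox : ∀ i ∈ S, ∀ x ∈ (d i).support, ∀ j, |x j| ≤ (R : ℤ))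
    (hdN : ∀ x, (∑ i ∈ S, d i) x ≤ N) {A : Finset ι} (hA : A ⊆ S) (m : ℂ) :
    njlCorrelation N L (∑ i ∈ A, d i) m =
      njlCapZ N (topExponent N - ∑ i ∈ A, plantFamily L d i) m /
        njlCapZ N (topExponent (ν := ν) (L := L) N) m := by
  rw [njlCorrelation_eq_div hL (sum_apply_le_of_subset hdN hA) (box_of_subset hbox hA), plant_sum]

omit [LinearOrder ι] in
/-- Degrees: `|N - L_A| + |L_A| = |N|` and `|L_A| = ∑_{i∈A} |L_i|`. [cite: SalmhoferSeiler1991, Remark 3.2] -/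
private theorem degree_top_sub_add (hL : 2 * R < L)
    (hbox : ∀ i ∈ S, ∀ x ∈ (d i).support, ∀ j, |x j| ≤ (R : ℤ))
    (hdN : ∀ x, (∑ i ∈ S, d i) x ≤ N) {A : Finset ι} (hA : A ⊆ S) :
    (topExponent (ν := ν) (L := L) N - ∑ i ∈ A, plantFamily L d i).degree +
        ∑ i ∈ A, (d i).degree = (topExponent (ν := ν) (L := L) N).degree := by
  have hle := plant_sum_le_top hL hbox hdN hA
  have hdeg : (∑ i ∈ A, plantFamily L d i).degree = ∑ i ∈ A, (d i).degree := by
    rw [map_sum]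
    refine sum_congr rfl fun i _ => ?_
    unfold plantFamily plant
    exact Finsupp.degree_mapDomain _ _
  rw [← hdeg, ← map_add, tsub_add_cancel_of_le hle]

/-- **The truncated function through the cleared Ursell polynomial** (for `m ≠ 0` with `Z_Λ(m) ≠ 0`,
`S` nonempty): `⟨σ^{L_{i₁}}; …⟩^T_Λ(m) = m^{-|L|} · (Z̃(N)|_{m^{-2}})^{-n} · Ũ|_{t ≡ m^{-2}}`.
[cite: SalmhoferSeiler1991, Thm. 3.11 and (3.33)] -/
theorem njlTruncated_eq (hN : 1 ≤ N) (hL : 2 * R < L)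
    (hbox : ∀ i ∈ S, ∀ x ∈ (d i).support, ∀ j, |x j| ≤ (R : ℤ))
    (hdN : ∀ x, (∑ i ∈ S, d i) x ≤ N) (hS : S.Nonempty) {m : ℂ} (hm : m ≠ 0)
    (hZ : njlCapZ N (topExponent (ν := ν) (L := L) N) m ≠ 0) :
    njlTruncated N L d S m =
      (m⁻¹) ^ (∑ i ∈ S, (d i).degree) *
        ((eval (fun _ => m⁻¹ ^ 2) (njlZgen N (topExponent (ν := ν) (L := L) N))) ^ S.card)⁻¹ *
          eval (fun _ => m⁻¹ ^ 2)
            (ursellGen N linkSrc linkTgt (njlSiteDataOne N) (njlBondCoeffC N)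
              (topExponent (ν := ν) (L := L) N) (plantFamily L d) S) := by
  have _ := hN
  have he₀ne : eval (fun _ => m⁻¹ ^ 2) (njlZgen N (topExponent (ν := ν) (L := L) N)) ≠ 0 := by
    intro h
    apply hZ
    rw [njlCapZ_eq_eval_njlZgen N _ hm, h, mul_zero]
  -- the moments of the sub-families: `E A = (∏_{i∈A} m^{-|L_i|}) · e(A)/e₀`
  have hE : ∀ A ⊆ S, njlCorrelation N L (∑ i ∈ A, d i) m =
      (∏ i ∈ A, (m⁻¹) ^ (d i).degree) *
        (eval (fun _ => m⁻¹ ^ 2) (njlZgen N (topExponent N - ∑ i ∈ A, plantFamily L d i)) /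
          eval (fun _ => m⁻¹ ^ 2) (njlZgen N (topExponent (ν := ν) (L := L) N))) := by
    intro A hA
    rw [correlation_eq_div hL hbox hdN hA, njlCapZ_eq_eval_njlZgen N _ hm,
      njlCapZ_eq_eval_njlZgen N _ hm, prod_pow_eq_pow_sum,
      ← degree_top_sub_add (ν := ν) hL hbox hdN hA, pow_add, mul_assoc,
      mul_div_mul_left _ _ (pow_ne_zero _ hm), div_mul_eq_div_div, div_right_comm, div_eq_mul_inv,
      mul_comm]
    simp only [inv_pow]
  have hu := Ursell.ursell_mul_prod (fun i => (m⁻¹) ^ (d i).degree) hE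
  have hcl := Ursell.clearedUrsell_eq
    (z := fun A => eval (fun _ => m⁻¹ ^ 2) (njlZgen N (topExponent N - ∑ i ∈ A, plantFamily L d i)))
    (z₀ := eval (fun _ => m⁻¹ ^ 2) (njlZgen N (topExponent (ν := ν) (L := L) N)))
    (E := fun A => eval (fun _ => m⁻¹ ^ 2) (njlZgen N (topExponent N - ∑ i ∈ A, plantFamily L d i)) /
      eval (fun _ => m⁻¹ ^ 2) (njlZgen N (topExponent (ν := ν) (L := L) N)))
    (fun A _ _ => by rw [mul_div_assoc', mul_div_cancel_left₀ _ he₀ne]) hS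
  have hgen : eval (fun _ => m⁻¹ ^ 2) (ursellGen N linkSrc linkTgt (njlSiteDataOne N)
      (njlBondCoeffC N) (topExponent (ν := ν) (L := L) N) (plantFamily L d) S) =
      Ursell.clearedUrsell
        (fun A => eval (fun _ => m⁻¹ ^ 2) (njlZgen N (topExponent N - ∑ i ∈ A, plantFamily L d i)))
        (eval (fun _ => m⁻¹ ^ 2) (njlZgen N (topExponent (ν := ν) (L := L) N))) S := by
    rw [eval_ursellGen]
    simp only [njlZgen, eval_Zgen]
  unfold njlTruncated
  rw [hu, prod_pow_eq_pow_sum, hgen, hcl, mul_assoc, ← mul_assoc ((_ ^ S.card)⁻¹),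
    inv_mul_cancel₀ (pow_ne_zero _ he₀ne), one_mul]

/-- Evaluating a polynomial all of whose monomials have degree `≥ T` at the constant point `w`,
`|w| ≤ 1`: `|p(w,…,w)| ≤ (∑ |coeff|) |w|^T`. [folklore] -/
private theorem norm_eval_const_le {σ : Type*} (p : MvPolynomial σ ℂ) {T : ℕ}
    (hT : ∀ k ∈ p.support, T ≤ k.degree) {w : ℂ} (hw : ‖w‖ ≤ 1) :
    ‖eval (fun _ => w) p‖ ≤ (∑ k ∈ p.support, ‖coeff k p‖) * ‖w‖ ^ T := by
  rw [eval_eq, sum_mul]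
  refine (norm_sum_le _ _).trans (sum_le_sum fun k hk => ?_)
  rw [norm_mul, prod_pow_eq_pow_sum, ← Finsupp.degree_apply, norm_pow]
  exact mul_le_mul_of_nonneg_left (pow_le_pow_of_le_one (norm_nonneg _) hw (hT k hk))
    (norm_nonneg _)

/-- **Order of vanishing at `m = ∞`.**  For a nonempty family of local observables planted in an
embedded box with total multi-index `≤ N`, the truncated function of the NJL system in the volume
`(ℤ/Lℤ)^ν` is `O(|m|^{-(|L| + 2ϑ)})` as `|m| → ∞`, `|L| = ∑_i |L_i|`, `ϑ` the tree length — the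
statement "for `|m| > m₀` the cluster expansion converges and the truncated correlations decay
exponentially, `u_L(m) ≤ -K(m) < 0`" in the form: each unit of tree length costs `m^{-2}`.
[cite: SalmhoferSeiler1991, Thm. 3.11 (proof, p. 408)] -/
theorem njlTruncated_isBigO (hN : 1 ≤ N) (hL : 2 * R < L)
    (hbox : ∀ i ∈ S, ∀ x ∈ (d i).support, ∀ j, |x j| ≤ (R : ℤ))
    (hdN : ∀ x, (∑ i ∈ S, d i) x ≤ N) (hS : S.Nonempty) :
    njlTruncated N L d S =O[cobounded ℂ]
      fun m : ℂ => (‖m‖⁻¹ ^ (∑ i ∈ S, (d i).degree + 2 * njlTreeLength L d S) : ℝ) := by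
  set top := topExponent (ν := ν) (L := L) N with htop
  set P := ursellGen N linkSrc linkTgt (njlSiteDataOne N) (njlBondCoeffC N) top (plantFamily L d) S
    with hP
  set Q := njlZgen N top with hQ
  set T := njlTreeLength L d S with hT
  set a := ∑ i ∈ S, (d i).degree with ha
  have htopN : ∀ x, top x ≤ N := fun x => by rw [htop, topExponent_apply']
  -- (1) eventually `m ≠ 0`, `Z_Λ(m) ≠ 0`, and the formula holds
  have hev : ∀ᶠ m : ℂ in cobounded ℂ, Real.sqrt (2 * ν) ≤ ‖m‖ ∧ 1 ≤ ‖m‖ := by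
    have h := (tendsto_norm_cobounded_atTop (E := ℂ)).eventually
      (eventually_ge_atTop (max (Real.sqrt (2 * ν)) 1))
    exact h.mono fun m hm => ⟨(le_max_left _ _).trans hm, (le_max_right _ _).trans hm⟩
  have hform : ∀ᶠ m : ℂ in cobounded ℂ, njlTruncated N L d S m =
      (m⁻¹) ^ a * ((eval (fun _ => m⁻¹ ^ 2) Q) ^ S.card)⁻¹ * eval (fun _ => m⁻¹ ^ 2) P := by
    filter_upwards [hev] with m hm
    have hm0 : m ≠ 0 := by
      rintro rfl; rw [norm_zero] at hm; exact absurd hm.2 (by norm_num)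
    exact njlTruncated_eq hN hL hbox hdN hS hm0 (njlCapZ_ne_zero hN htopN hm0 hm.1)
  -- (2) the polynomial factor is `O(|m|^{-2T})`: all its monomials have degree `≥ T`
  have hdegP : ∀ k ∈ P.support, T ≤ k.degree := fun k hk =>
    steiner_le_degree_of_mem_support_ursellGen (fun b => by simp [njlBondCoeffC, njlBondCoeff])
      htopN (fun x => by
        simp only [njlSiteDataOne]
        exact div_ne_zero (pow_ne_zero _ (by exact_mod_cast (show (2 * N : ℕ) ≠ 0 by omega)))
          (by exact_mod_cast (Nat.factorial_pos _).ne')) hk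
  have hOP : (fun m : ℂ => eval (fun _ => m⁻¹ ^ 2) P) =O[cobounded ℂ]
      fun m : ℂ => (‖m‖⁻¹ ^ (2 * T) : ℝ) := by
    refine IsBigO.of_bound (∑ k ∈ P.support, ‖coeff k P‖) ?_
    filter_upwards [hev] with m hm
    have hw : ‖(m⁻¹ ^ 2 : ℂ)‖ ≤ 1 := by
      rw [norm_pow, norm_inv]
      exact pow_le_one₀ (inv_nonneg.2 (norm_nonneg _)) (inv_le_one_of_one_le₀ hm.2)
    refine (norm_eval_const_le P hdegP hw).trans (le_of_eq ?_)
    rw [Real.norm_of_nonneg (by positivity), norm_pow, norm_inv, ← pow_mul, mul_comm 2 T]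
  -- (3) the denominator tends to a nonzero limit, hence its inverse power is bounded
  have hτ : Tendsto (fun m : ℂ => (fun _ : TorusSite ν L × Fin ν => m⁻¹ ^ 2)) (cobounded ℂ)
      (𝓝 (0 : TorusSite ν L × Fin ν → ℂ)) := by
    rw [tendsto_pi_nhds]
    intro _
    have h := (tendsto_inv₀_cobounded (α := ℂ)).pow 2
    rw [zero_pow two_ne_zero] at h
    exact h
  have hQlim : Tendsto (fun m : ℂ => eval (fun _ => m⁻¹ ^ 2) Q) (cobounded ℂ)
      (𝓝 (eval (0 : TorusSite ν L × Fin ν → ℂ) Q)) :=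
    ((MvPolynomial.continuous_eval Q).tendsto _).comp hτ
  have hQ0 : eval (0 : TorusSite ν L × Fin ν → ℂ) Q ≠ 0 := eval_zero_njlZgen_ne_zero hN htopN
  set q₀ := ‖eval (0 : TorusSite ν L × Fin ν → ℂ) Q‖ with hq₀
  have hq₀pos : 0 < q₀ := norm_pos_iff.2 hQ0
  have hQev : ∀ᶠ m : ℂ in cobounded ℂ, q₀ / 2 ≤ ‖eval (fun _ => m⁻¹ ^ 2) Q‖ := by
    have h := (continuous_norm.tendsto _).comp hQlim
    have h2 : ∀ᶠ m : ℂ in cobounded ℂ, q₀ / 2 < ‖eval (fun _ => m⁻¹ ^ 2) Q‖ :=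
      h.eventually (lt_mem_nhds (by rw [hq₀]; linarith))
    exact h2.mono fun m hm => hm.le
  have hOQ : (fun m : ℂ => ((eval (fun _ => m⁻¹ ^ 2) Q) ^ S.card)⁻¹) =O[cobounded ℂ]
      fun _ : ℂ => (1 : ℝ) := by
    refine IsBigO.of_bound ((q₀ / 2) ^ S.card)⁻¹ ?_
    filter_upwards [hQev] with m hm
    rw [norm_one, mul_one, norm_inv, norm_pow]
    exact inv_anti₀ (pow_pos (by positivity) _) (pow_le_pow_left₀ (by positivity) hm _)
  -- (4) the explicit power of `m`
  have hOm : (fun m : ℂ => (m⁻¹) ^ a) =O[cobounded ℂ] fun m : ℂ => (‖m‖⁻¹ ^ a : ℝ) := by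
    refine IsBigO.of_bound 1 (Eventually.of_forall fun m => ?_)
    rw [norm_pow, norm_inv, one_mul, Real.norm_of_nonneg (by positivity)]
  -- assemble
  refine (IsBigO.congr' ((hOm.mul hOQ).mul hOP) (hform.mono fun m hm => hm.symm)
    (Eventually.of_forall fun m => ?_))
  show (‖m‖⁻¹ ^ a * 1 * ‖m‖⁻¹ ^ (2 * T) : ℝ) = ‖m‖⁻¹ ^ (a + 2 * T)
  rw [mul_one, ← pow_add]

/-- **The uniform majorant outside the ellipses** (the Erratum's `C_n B_n(m)`): for `0 < |w| ≤ r < 1`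
and `m = (√(2ν)/2)(w⁻¹ - w)`, `|⟨σ^{L_{i₁}}; …⟩^T_Λ(m)| ≤ 2^{n²} A(r)^{|L|}` in every volume.
[cite: SalmhoferSeiler1992Erratum, (1)–(3)][cite: SalmhoferSeiler1991, (3.33)–(3.34)] -/
theorem norm_njlTruncated_joukowskiMass_le (hN : 1 ≤ N) (hν : 1 ≤ ν) (L : ℕ) [NeZero L]
    (d : ι → Site ν →₀ ℕ) (S : Finset ι) {r : ℝ} (hr : r < 1) {w : ℂ} (hw0 : w ≠ 0)
    (hwr : ‖w‖ ≤ r) :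
    ‖njlTruncated N L d S (joukowskiMass (Real.sqrt (2 * ν)) w)‖ ≤
      2 ^ (S.card ^ 2) * njlSpinMajorant ν r ^ (∑ i ∈ S, (d i).degree) := by
  unfold njlTruncated
  rw [← prod_pow_eq_pow_sum]
  refine Ursell.norm_ursell_le (fun i _ => pow_nonneg (njlSpinMajorant_nonneg ν r) _)
    fun A _ => ?_
  rw [prod_pow_eq_pow_sum, ← map_sum]
  exact norm_njlCorrelation_joukowskiMass_le hN hν L _ hr hw0 hwr

/-- **Theorem 3.11 for the truncated `n`-point functions, every `n`, every volume — Joukowski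
form.**  For the NJL system with `N ≥ 1` colours on the torus `(ℤ/Lℤ)^ν` (`ν ≥ 1`), a nonempty
family of local monomial observables `σ^{L_i}` (`i ∈ S`) supported in the box `|x|_∞ ≤ R`
(`2R < L`) with `∑_i L_i ≤ N` pointwise, every `r < 1` and every `0 < |w| < r`, at the mass
`m = (√(2ν)/2)(w⁻¹ - w)` (these exhaust `ℂ ∖ i[-√(2ν), √(2ν)]` as `r → 1`):
`|⟨σ^{L_{i₁}}; …; σ^{L_{i_n}}⟩^T_Λ(m)| ≤ 2^{n²} A(r)^{|L|} (|w|/r)^{|L| + 2ϑ}`, `ϑ` the tree length of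
the family: exponential clustering with rate `2 log(r/|w|)` per unit of tree length — the same rate
as for `n = 2`, independent of `n` (Remark 3.12) — and the Erratum's prefactor.  The order of
vanishing `|L| + 2ϑ` at `m = ∞` comes from the support theorem of
`CapacityPartitionFunctionConnectedness` (in print: the cluster expansion), the conversion into a
decay rate on the whole region from the Penrose–Lebowitz/Schwarz step of `NJLExponentialClustering`
(in print: subharmonicity of `u_L`, (3.35)–(3.42)). [cite: SalmhoferSeiler1991, Thm. 3.11 (3.32) and Remark 3.12][cite: SalmhoferSeiler1992Erratum, (1)–(3)] -/
theorem njl_truncated_clustering_joukowskiMass (hN : 1 ≤ N) (hν : 1 ≤ ν) {L : ℕ} [NeZero L]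
    {d : ι → Site ν →₀ ℕ} {S : Finset ι} {R : ℕ} (hL : 2 * R < L)
    (hbox : ∀ i ∈ S, ∀ x ∈ (d i).support, ∀ j, |x j| ≤ (R : ℤ))
    (hdN : ∀ x, (∑ i ∈ S, d i) x ≤ N) (hS : S.Nonempty)
    {r : ℝ} (hr : r < 1) {w : ℂ} (hw0 : w ≠ 0) (hw : ‖w‖ < r) :
    ‖njlTruncated N L d S (joukowskiMass (Real.sqrt (2 * ν)) w)‖ ≤
      2 ^ (S.card ^ 2) * njlSpinMajorant ν r ^ (∑ i ∈ S, (d i).degree) *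
        (‖w‖ / r) ^ (∑ i ∈ S, (d i).degree + 2 * njlTreeLength L d S) := by
  have hνpos : (0 : ℝ) < ν := by exact_mod_cast Nat.lt_of_lt_of_le Nat.zero_lt_one hν
  have hs0 : 0 < Real.sqrt (2 * (ν : ℝ)) := Real.sqrt_pos.2 (by positivity)
  have hFd : DifferentiableOn ℂ (njlTruncated N L d S)
      {m : ℂ | m.re ≠ 0 ∨ Real.sqrt (2 * (ν : ℝ)) < ‖m‖} :=
    differentiableOn_njlTruncated N L d S
  exact norm_le_mul_pow_of_isBigO_cobounded hs0 hr.le hFd (njlTruncated_isBigO hN hL hbox hdN hS)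
    (fun z hz0 hz => norm_njlTruncated_joukowskiMass_le hN hν L d S hr hz0 hz.le) hw0 hw

/-- **Theorem 3.11 (every `n`) at every mass off `i[-√(2ν), √(2ν)]`, uniformly in the volume**: for
every such `m` there is `q = q(m) ∈ (0,1)` with, for every `r ∈ (q, 1)`, every volume, every `n`
and every admissible family `σ^{L_1}, …, σ^{L_n}`:
`|⟨σ^{L_1}; …; σ^{L_n}⟩^T_Λ(m)| ≤ 2^{n²} A(r)^{|L|} (q/r)^{|L| + 2ϑ}`. [cite: SalmhoferSeiler1991, Thm. 3.11 (3.32)][cite: SalmhoferSeiler1992Erratum, (1)–(2)] -/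
theorem njl_truncated_clustering_of_mem (hN : 1 ≤ N) (hν : 1 ≤ ν) {m : ℂ}
    (hm : m ∈ njlMassRegion ν) :
    ∃ q : ℝ, 0 < q ∧ q < 1 ∧ ∀ r : ℝ, q < r → r < 1 →
      ∀ (L : ℕ) [NeZero L] (n : ℕ) (d : Fin n → Site ν →₀ ℕ) (S : Finset (Fin n)) (R : ℕ),
        2 * R < L → (∀ i ∈ S, ∀ x ∈ (d i).support, ∀ j, |x j| ≤ (R : ℤ)) →
        (∀ x, (∑ i ∈ S, d i) x ≤ N) → S.Nonempty →
        ‖njlTruncated N L d S m‖ ≤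
          2 ^ (S.card ^ 2) * njlSpinMajorant ν r ^ (∑ i ∈ S, (d i).degree) *
            (q / r) ^ (∑ i ∈ S, (d i).degree + 2 * njlTreeLength L d S) := by
  have hνpos : (0 : ℝ) < ν := by exact_mod_cast Nat.lt_of_lt_of_le Nat.zero_lt_one hν
  have hs0 : 0 < Real.sqrt (2 * (ν : ℝ)) := Real.sqrt_pos.2 (by positivity)
  obtain ⟨w, hw0, hw1, hwm⟩ := exists_joukowskiMass_eq hs0 hm
  refine ⟨‖w‖, norm_pos_iff.2 hw0, hw1, fun r hqr hr L _ n d S R hL hbox hdN hS => ?_⟩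
  rw [← hwm]
  exact njl_truncated_clustering_joukowskiMass hN hν hL hbox hdN hS hr hw0 hqr

/-- `(q/r)^{2D} = exp(-κ D)` with `κ = 2 log(r/q)`. [folklore] -/
private theorem pow_eq_exp_neg' {q r : ℝ} (hq : 0 < q) (hr : 0 < r) (D : ℕ) :
    (q / r) ^ (2 * D) = Real.exp (-(2 * Real.log (r / q)) * D) := by
  have hqr : 0 < q / r := div_pos hq hr
  rw [← Real.exp_log (pow_pos hqr (2 * D)), Real.log_pow, Real.log_div hq.ne' hr.ne',
    Real.log_div hr.ne' hq.ne']
  congr 1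
  push_cast
  ring

/-- **Theorem 3.11 with the Erratum, exponential form, every `n`**: for every `m` off
`i[-√(2ν), √(2ν)]` there is ONE rate `κ(m) > 0` — independent of `n` (Remark 3.12) — and a base
`A = A(m) ≥ 0` such that for every volume, every `n` and every admissible family
`σ^{L_1}, …, σ^{L_n}` (supports in an embedded box, `∑ L_i ≤ N`):
`|⟨σ^{L_1}; …; σ^{L_n}⟩^T_Λ(m)| ≤ 2^{n²} A^{|L|} e^{-κ(m) ϑ(L_1,…,L_n)}` — "(1), where `C_n` depends
only on `n`" and `B_n(m) = A^{|L|}`. [cite: SalmhoferSeiler1991, Thm. 3.11 (3.32) and Remark 3.12][cite: SalmhoferSeiler1992Erratum, (1)–(2)] -/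
theorem njl_truncated_exponentialClustering (hN : 1 ≤ N) (hν : 1 ≤ ν) {m : ℂ}
    (hm : m ∈ njlMassRegion ν) :
    ∃ κ : ℝ, 0 < κ ∧ ∃ A : ℝ, 0 ≤ A ∧
      ∀ (L : ℕ) [NeZero L] (n : ℕ) (d : Fin n → Site ν →₀ ℕ) (S : Finset (Fin n)) (R : ℕ),
        2 * R < L → (∀ i ∈ S, ∀ x ∈ (d i).support, ∀ j, |x j| ≤ (R : ℤ)) →
        (∀ x, (∑ i ∈ S, d i) x ≤ N) → S.Nonempty →
        ‖njlTruncated N L d S m‖ ≤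
          2 ^ (S.card ^ 2) * A ^ (∑ i ∈ S, (d i).degree) *
            Real.exp (-κ * njlTreeLength L d S) := by
  obtain ⟨q, hq0, hq1, h⟩ := njl_truncated_clustering_of_mem hN hν hm
  set r : ℝ := (q + 1) / 2 with hr
  have hqr : q < r := by rw [hr]; linarith
  have hr1 : r < 1 := by rw [hr]; linarith
  have hr0 : 0 < r := hq0.trans hqr
  have hqr1 : q / r ≤ 1 := (div_le_one hr0).2 hqr.le
  refine ⟨2 * Real.log (r / q), ?_, njlSpinMajorant ν r, njlSpinMajorant_nonneg ν r,
    fun L _ n d S R hL hbox hdN hS => ?_⟩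
  · have : 1 < r / q := by rw [lt_div_iff₀ hq0]; linarith
    have := Real.log_pos this
    positivity
  · refine (h r hqr hr1 L n d S R hL hbox hdN hS).trans ?_
    apply mul_le_mul_of_nonneg_left _
      (mul_nonneg (by positivity) (pow_nonneg (njlSpinMajorant_nonneg ν r) _))
    calc (q / r) ^ (∑ i ∈ S, (d i).degree + 2 * njlTreeLength L d S)
        ≤ (q / r) ^ (2 * njlTreeLength L d S) :=
          pow_le_pow_of_le_one (div_pos hq0 hr0).le hqr1 (Nat.le_add_left _ _)
      _ = Real.exp (-(2 * Real.log (r / q)) * ↑(njlTreeLength L d S)) :=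
          pow_eq_exp_neg' hq0 hr0 _

end Truncated

end ComplexSpin

end Literature.MathematicalPhysics.StatisticalMechanics
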